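import Literature.MathematicalPhysics.QuantumManyBody.TorusGalerkinScattering
import HarnessLib

/-!
# Uniform bounds for the Galerkin scattering amplitudes from positivity alone

Topic `Literature/MathematicalPhysics/QuantumManyBody`; theorem-only sequel of
`TorusGalerkinScattering.lean` for the provefact
`Literature.MathematicalPhysics.QuantumManyBody.BoseGas.BastiCenatiempoSchlein2021_upperBound`
(the bound `|η_p| ≤ CN^κ/p²`, (2.4) of [BastiCenatiempoSchlein2021], for the Galerkin minimiser).

The quadratic form `B(u,u) = ∑_{a,b} W(e a - e b) u_a u_b` of the pair coefficients is positive
semidefinite (Bochner, `sum_sum_re_potFT_mul_mul_nonneg`). On the band extended by a zero-momentum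
slot (`Option ι`, as in `galerkinPot_re_potFT_nonneg`) the vector `x = δ₀ - c` has `B(x,x) = Q(c)`
(the potential form `galerkinPot`), `y = δ_p` has `B(y,y) = W(0)`, and `B(x,y) = W(e p) - ∑W(e p - e q)c_q`
is the right side `ĝ_p` of the scattering equation. Hence (`sq_gHat_le`) `ĝ_p² ≤ W(0)·Q(c)`, and for a
minimiser `Q(c) ≤ 2L³E(c) ≤ 2L³E(0) = W(0)` (`galerkinPot_le_of_min`), so
`2L³ε_p|c_p| = |ĝ_p| ≤ W(0)` on every mode (`abs_coeff_le_of_min`) — the analogue of (2.4) with the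
explicit constant `W(0) = ∫v`, no maximum principle and no regularity of the potential.

## References

* [BastiCenatiempoSchlein2021] G. Basti, S. Cenatiempo, B. Schlein, Forum Math. Sigma 9 (2021) e74,
  arXiv:2101.06222: (2.4), Lemma 2.2.
-/

noncomputable section

namespace Literature.MathematicalPhysics.QuantumManyBody.BoseGas

open Finset
open scoped BigOperators

section PSD

variable {κ : Type*} [Fintype κ]

/-- **Cauchy–Schwarz for a positive semidefinite symmetric form** on a finite index set:
`B(x,y)² ≤ B(x,x)B(y,y)`. [folklore] -/
theorem psd_cauchy_schwarz (B : κ → κ → ℝ) (hsymm : ∀ a b, B a b = B b a)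
    (hpos : ∀ u : κ → ℝ, 0 ≤ ∑ a, ∑ b, B a b * u a * u b) (x y : κ → ℝ) :
    (∑ a, ∑ b, B a b * x a * y b) ^ 2 ≤ (∑ a, ∑ b, B a b * x a * x b) * (∑ a, ∑ b, B a b * y a * y b) := by
  set P := ∑ a, ∑ b, B a b * x a * x b with hP
  set R := ∑ a, ∑ b, B a b * y a * y b with hR
  set M := ∑ a, ∑ b, B a b * x a * y b with hM
  have hM' : ∑ a, ∑ b, B a b * y a * x b = M := by
    rw [hM, Finset.sum_comm]
    exact Finset.sum_congr rfl fun a _ => Finset.sum_congr rfl fun b _ => by rw [hsymm]; ring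
  -- `B(x + t y, x + t y) = P + 2tM + t²R ≥ 0` for all `t`
  have hquad : ∀ t : ℝ, 0 ≤ P + 2 * t * M + t ^ 2 * R := by
    intro t
    have h := hpos (fun a => x a + t * y a)
    have hexp : ∑ a, ∑ b, B a b * (x a + t * y a) * (x b + t * y b) = P + 2 * t * M + t ^ 2 * R := by
      have : ∀ a b, B a b * (x a + t * y a) * (x b + t * y b) =
          B a b * x a * x b + t * (B a b * x a * y b) + t * (B a b * y a * x b) + t ^ 2 * (B a b * y a * y b) := by
        intro a b; ring
      simp only [this, Finset.sum_add_distrib, ← Finset.mul_sum]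
      rw [hM', ← hP, ← hM, ← hR]; ring
    rw [hexp] at h; exact h
  have hP0 : 0 ≤ P := by simpa using hquad 0
  have hR0 : 0 ≤ R := hpos y
  by_cases hR' : R = 0
  · -- then `M = 0`
    have hM0 : M = 0 := by
      by_contra hM0
      have h := hquad (-(P + 1) / (2 * M))
      have : P + 2 * (-(P + 1) / (2 * M)) * M + (-(P + 1) / (2 * M)) ^ 2 * R = -1 := by
        rw [hR']; field_simp; ring
      linarith
    rw [hM0, hR']; simp
  · have hRpos : 0 < R := lt_of_le_of_ne hR0 (Ne.symm hR')
    have h := hquad (-M / R)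
    have : P + 2 * (-M / R) * M + (-M / R) ^ 2 * R = P - M ^ 2 / R := by field_simp; ring
    rw [this] at h
    have h2 : M ^ 2 / R ≤ P := by linarith
    rwa [div_le_iff₀ hRpos] at h2

end PSD

section Galerkin

variable {ι : Type*} [Fintype ι] [DecidableEq ι] {e : ι → Momentum} {ε : ι → ℝ} {W : Momentum → ℝ} {L : ℝ}

/-- **`ĝ_p² ≤ W(0)·Q(c)`** for every mode: with the zero-momentum slot adjoined (`Option ι`,
momenta `0, e`) and Bochner positivity of `W` on it,
`(W(e p) - ∑_qW(e p - e q)c_q)² ≤ W(0)·[W(0) - 2∑W(e q)c_q + ∑∑W(e p-e q)c_pc_q]`.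
[cite: BastiCenatiempoSchlein2021, (2.4) (the mechanism behind `|η_p| ≤ CN^κ/p²`, here by positivity)] -/
theorem sq_gHat_le (hWev : ∀ k, W (-k) = W k)
    (hpos : ∀ u : Option ι → ℝ, 0 ≤ ∑ a, ∑ b, W ((a.elim 0 e) - (b.elim 0 e)) * u a * u b)
    (c : ι → ℝ) (p : ι) :
    (W (e p) - ∑ q, W (e p - e q) * c q) ^ 2 ≤ W 0 * galerkinPot e W c := by
  classical
  set B : Option ι → Option ι → ℝ := fun a b => W ((a.elim 0 e) - (b.elim 0 e)) with hB
  have hsymm : ∀ a b, B a b = B b a := fun a b => by simp only [hB]; rw [← hWev, neg_sub]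
  set x : Option ι → ℝ := fun a => a.elim 1 (fun q => -c q) with hx
  set y : Option ι → ℝ := fun a => a.elim 0 (fun q => if q = p then 1 else 0) with hy
  have h := psd_cauchy_schwarz B hsymm hpos x y
  -- evaluate the three forms
  have hxy : ∑ a, ∑ b, B a b * x a * y b = W (e p) - ∑ q, W (e p - e q) * c q := by
    simp only [hB, hx, hy, Fintype.sum_option, Option.elim]
    simp only [mul_zero, zero_add, mul_ite, mul_one, Finset.sum_ite_eq', Finset.mem_univ, if_true, zero_sub]
    rw [hWev]
    have : ∀ q, W (e q - e p) * -c q = -(W (e p - e q) * c q) := fun q => by rw [← hWev, neg_sub]; ring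
    simp only [this, Finset.sum_neg_distrib]
    ring
  have hxx : ∑ a, ∑ b, B a b * x a * x b = galerkinPot e W c := by
    simp only [hB, hx, Fintype.sum_option, Option.elim, galerkinPot]
    simp only [sub_zero, zero_sub, mul_one, mul_neg, neg_mul, neg_neg, Finset.sum_neg_distrib, hWev,
      sub_self]
    rw [Finset.sum_add_distrib, Finset.sum_neg_distrib]
    ring
  have hyy : ∑ a, ∑ b, B a b * y a * y b = W 0 := by
    simp only [hB, hy, Fintype.sum_option, Option.elim]
    simp only [mul_zero, zero_add, mul_ite, mul_one, Finset.sum_ite_eq', Finset.mem_univ, if_true, sub_self]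
  rw [hxy, hxx, hyy] at h
  linarith [h]

omit [DecidableEq ι] in
/-- **The potential form of a minimiser is at most `W(0)`**: `Q(c) ≤ 2L³E(c) ≤ 2L³E(0) = W(0)`
(`ε ≥ 0`). [folklore] -/
theorem galerkinPot_le_of_min (hL : 0 < L) (hε : ∀ p, 0 ≤ ε p) {c : ι → ℝ}
    (hmin : ∀ c', galerkinEnergy e ε W L c ≤ galerkinEnergy e ε W L c') :
    galerkinPot e W c ≤ W 0 := by
  have h := hmin (fun _ => 0)
  have hE0 : galerkinEnergy e ε W L (fun _ => 0) = (2 * L ^ 3)⁻¹ * W 0 := by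
    simp [galerkinEnergy, galerkinPot]
  have hkin : 0 ≤ ∑ p, ε p * c p ^ 2 := Finset.sum_nonneg fun p _ => mul_nonneg (hε p) (sq_nonneg _)
  have hL3 : 0 < (2 * L ^ 3)⁻¹ := by positivity
  rw [hE0] at h
  unfold galerkinEnergy at h
  have h2 : (2 * L ^ 3)⁻¹ * galerkinPot e W c ≤ (2 * L ^ 3)⁻¹ * W 0 := by linarith
  exact le_of_mul_le_mul_left h2 hL3

/-- **`|ĝ_p| ≤ W(0)`, hence `2L³ε_p|c_p| ≤ W(0)` on every mode of a minimiser** — the uniform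
pointwise bound (2.4) `|η_p| ≤ CN^κ/p²` (`η = -Nc`, `N W(0)/(2L³ε_p) = ρW(0)/(2ε_p)`) with the
explicit constant `W(0) = ∫v`. [cite: BastiCenatiempoSchlein2021, (2.4), Lemma 2.2] -/
theorem abs_coeff_le_of_min (hL : 0 < L) (hε : ∀ p, 0 ≤ ε p) (hWev : ∀ k, W (-k) = W k) (hW0 : 0 ≤ W 0)
    (hpos : ∀ u : Option ι → ℝ, 0 ≤ ∑ a, ∑ b, W ((a.elim 0 e) - (b.elim 0 e)) * u a * u b)
    {c : ι → ℝ} (hmin : ∀ c', galerkinEnergy e ε W L c ≤ galerkinEnergy e ε W L c')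
    (hEL : ∀ p, 2 * L ^ 3 * ε p * c p = W (e p) - ∑ q, W (e p - e q) * c q) (p : ι) :
    |2 * L ^ 3 * ε p * c p| ≤ W 0 := by
  rw [hEL p]
  have h1 := sq_gHat_le hWev hpos c p
  have h2 := galerkinPot_le_of_min hL hε hmin
  have h3 : (W (e p) - ∑ q, W (e p - e q) * c q) ^ 2 ≤ W 0 ^ 2 := by
    calc _ ≤ W 0 * galerkinPot e W c := h1
      _ ≤ W 0 * W 0 := mul_le_mul_of_nonneg_left h2 hW0
      _ = W 0 ^ 2 := by ring
  exact abs_le_of_sq_le_sq' h3 hW0 |> fun h => abs_le.2 h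

end Galerkin

end Literature.MathematicalPhysics.QuantumManyBody.BoseGas

end
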